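import Summits.AtomisticToContinuum.HydrodynamicLimit.Theorems.RelayRaceLocalityLightConeInLawSketchLine
import Summits.AtomisticToContinuum.HydrodynamicLimit.Theorems.DenseExcursion.Negative.AtTimeZero
import Literature.MathematicalPhysics.KineticTheory.HardSphereEulerProofs

/-!
# Stub `stub_profileIdOne` of the line `Sketch` for the crux `LightConeInLaw`
(stmt-AtomisticToContinuum-12500; route `RelayRaceLocality`, sub-problem `HydrodynamicLimit`)

**Profile identification for the `(N+1)`-sphere local Gibbs family (statics).** If, under the
local Gibbs laws `localGibbsLaw σ a u θ N (Φ N)` of `N + 1` hard spheres with continuous profiles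
`a, θ > 0`, `u`, the empirical density / momentum / energy fields at time `0` converge in
probability to `(ρ₀, ρ₀ U₀, ρ₀(|U₀|²/2 + 3Θ₀/2))` for continuous `ρ₀ > 0`, `U₀`, `Θ₀`
(`TendstoHydroFieldsAt … (fun _ => ρ₀) (fun _ => U₀) (fun _ => Θ₀) 0`), then `U₀ = u` and
`Θ₀ = θ`: the Euler velocity and temperature data ARE the Gibbs profiles.

Proof. The flow at time `0` is the identity a.e. (`localGibbsLaw_preimage_flow_zero`), so the
three limits hold for the flow-free `localGibbsMeasure`. Conditionally on the positions the
velocities are independent Gaussians `N(u(xᵢ), θ(xᵢ))`, so the velocity fluctuations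
`(N+1)⁻¹ ∑ χ(xᵢ)(vᵢˡ − uˡ(xᵢ))` and `(N+1)⁻¹ ∑ χ(xᵢ)(|vᵢ|²/2 − |u(xᵢ)|²/2 − 3θ(xᵢ)/2)` are
`O((N+1)^{-1/2})` in probability (`localGibbsMeasure_velFluct_le`, Bienaymé–Chebyshev). Hence the
`l`-th momentum coordinate tends in probability both to `∫ χ ρ₀ U₀ˡ` (hypothesis) and to
`∫ χ uˡ ρ₀` (density hypothesis with the test function `χ uˡ` plus the fluctuation bound); limits
in probability under probability measures are unique, so `∫ χ ρ₀ (U₀ˡ − uˡ) = 0` for every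
continuous `χ`, whence `ρ₀ U₀ˡ = ρ₀ uˡ` (continuity; the Haar measure charges open sets) and
`U₀ = u` (`ρ₀ > 0`). The energy field gives `ρ₀(|U₀|²/2 + 3Θ₀/2) = ρ₀(|u|²/2 + 3θ/2)` in the same
way, and with `U₀ = u` this is `Θ₀ = θ`. This is the forward assembly
`localGibbs_lln_of_densityLLN` of the tree run backwards; no named fact is used. The two folklore
lemmas (uniqueness of limits in probability, `DenseExcursionAtTimeZero.eq_of_tendsto_measure_lt_abs`;
continuous functions with equal integrals against continuous test functions are equal,
`DenseExcursionAtTimeZero.eq_of_forall_integral_mul_eq`) are imported from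
`Theorems/DenseExcursion/Negative/AtTimeZero.lean`.
-/

namespace Summit.AtomisticToContinuum.HydrodynamicLimit.Theorems.LightConeInLawSketch.ProfileIdOne

open scoped BigOperators Topology Classical ENNReal
open Filter Set MeasureTheory ProbabilityTheory
open Literature.MathematicalPhysics.KineticTheory Literature.Analysis.FluidPDE

noncomputable section

/-! ### A coordinate of a vector-valued integral -/

/-- A coordinate of a vector-valued integral of continuous data on `𝕋³`:
`(∫ (χρ₀) • U₀)ˡ = ∫ χ (ρ₀ U₀ˡ)`. [folklore] -/
theorem integral_smul_apply_eq {χ ρ₀ : T3 → ℝ} {U₀ : T3 → V3} (hχ : Continuous χ)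
    (hρc : Continuous ρ₀) (hUc : Continuous U₀) (l : Fin 3) :
    (∫ x, (χ x * ρ₀ x) • U₀ x) l = ∫ x, χ x * (ρ₀ x * U₀ x l) := by
  have hint : Integrable (fun x => (χ x * ρ₀ x) • U₀ x) :=
    integrable_of_continuous_T3 ((hχ.mul hρc).smul hUc)
  rw [show (∫ x, (χ x * ρ₀ x) • U₀ x) l =
      (EuclideanSpace.proj l : V3 →L[ℝ] ℝ) (∫ x, (χ x * ρ₀ x) • U₀ x) from rfl,
    ← ContinuousLinearMap.integral_comp_comm _ hint]
  refine integral_congr_ae (Eventually.of_forall fun x => ?_)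
  simp only [EuclideanSpace.coe_proj, PiLp.smul_apply, smul_eq_mul]
  ring

/-! ### Velocity fluctuations under the `(N+1)`-sphere local Gibbs measures -/

variable {a θ : T3 → ℝ} {u : T3 → V3} {σ : ℝ}

/-- **Velocity fluctuations tend to zero** (rate `(N+1)⁻¹`) whenever the local Gibbs measures are
probability measures: the `Tendsto` form of `localGibbsMeasure_velFluct_le`. [folklore] -/
theorem tendsto_velFluct (ha : Continuous a) (hθ : Continuous θ) (hu : Continuous u)
    (ha0 : ∀ x, 0 ≤ a x) (hθ0 : ∀ x, 0 < θ x)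
    (hP : ∀ N, IsProbabilityMeasure (localGibbsMeasure σ a u θ N))
    {Y : T3 → V3 → ℝ} (hYm : Measurable fun p : T3 × V3 => Y p.1 p.2)
    (hY2 : ∀ x, MemLp (Y x) 2 (gaussMeasure (u x) (θ x)))
    (hY0 : ∀ x, ∫ v, Y x v ∂gaussMeasure (u x) (θ x) = 0)
    {B : ℝ} (hYB : ∀ x, Var[Y x; gaussMeasure (u x) (θ x)] ≤ B)
    {χ : T3 → ℝ} (hχ : Continuous χ) {η : ℝ} (hη : 0 < η) :
    Tendsto (fun N => localGibbsMeasure σ a u θ N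
      {z | η ≤ |((N + 1 : ℕ) : ℝ)⁻¹ * ∑ i, χ (z i).1 * Y (z i).1 (z i).2|}) atTop (𝓝 0) := by
  obtain ⟨C, -, hC⟩ := exists_forall_abs_le_of_continuous hχ
  refine tendsto_of_tendsto_of_tendsto_of_le_of_le tendsto_const_nhds
    (tendsto_ofReal_div_succ_mul (C ^ 2 * B) (η ^ 2)) (fun _ => zero_le) (fun N => ?_)
  haveI := hP N
  exact localGibbsMeasure_velFluct_le ha hθ hu ha0 hθ0 σ N hYm hY2 hY0 hYB hχ hC hη

/-- **Momentum coordinates, backwards.** If the empirical density fields satisfy a law of large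
numbers towards `ρ₀` under the local Gibbs measures, then the `l`-th coordinate of the empirical
momentum field tested against `χ` tends in probability to `∫ χ uˡ ρ₀` (fluctuation + density field
with the continuous weight `χ uˡ`, `empiricalMomentumField_apply_sub`). [folklore] -/
theorem tendsto_momentum_apply (ha : Continuous a) (hθ : Continuous θ) (hu : Continuous u)
    (ha0 : ∀ x, 0 ≤ a x) (hθ0 : ∀ x, 0 < θ x)
    (hP : ∀ N, IsProbabilityMeasure (localGibbsMeasure σ a u θ N)) {ρ₀ : T3 → ℝ}
    (hD : ∀ χ : T3 → ℝ, Continuous χ → ∀ δ : ℝ, 0 < δ →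
      Tendsto (fun N => localGibbsMeasure σ a u θ N
        {w | δ < |empiricalDensityField w χ - ∫ y, χ y * ρ₀ y|}) atTop (𝓝 0))
    {χ : T3 → ℝ} (hχ : Continuous χ) (l : Fin 3) {δ : ℝ} (hδ : 0 < δ) :
    Tendsto (fun N => localGibbsMeasure σ a u θ N
      {w | δ < |empiricalMomentumField w χ l - ∫ y, χ y * u y l * ρ₀ y|}) atTop (𝓝 0) := by
  obtain ⟨Θ, -, hΘ⟩ := exists_forall_abs_le_of_continuous hθ
  have hA := tendsto_velFluct ha hθ hu ha0 hθ0 hP (Y := fun x v => v l - u x l) (by fun_prop)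
    (fun x => (memLp_coord_gaussMeasure (u x) (θ x) l 2 (by simp)).sub (memLp_const _))
    (fun x => by
      rw [integral_sub ((memLp_coord_gaussMeasure (u x) (θ x) l 2 (by simp)).integrable
        one_le_two) (integrable_const _), integral_coord_gaussMeasure _ (hθ0 x), integral_const]
      simp)
    (B := Θ) (fun x => by
      rw [variance_sub_const (X := fun v : V3 => v l)
        (by fun_prop : Continuous fun v : V3 => v l).aestronglyMeasurable,
        variance_coord_gaussMeasure _ (hθ0 x).le]
      exact (le_abs_self _).trans (hΘ x))
    hχ (half_pos hδ)
  have hB := hD (fun y => χ y * u y l) (hχ.mul (by fun_prop)) (δ / 2) (half_pos hδ)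
  refine (tendsto_measure_lt_abs_add hA hB).congr fun N => ?_
  congr 1
  ext w
  simp only [Set.mem_setOf_eq]
  rw [empiricalMomentumField_apply_sub w χ u l, empiricalDensityField_eq_sum,
    show (2 : ℝ) * (δ / 2) = δ by ring]

/-- **Energy field, backwards.** Under the same density law of large numbers, the empirical energy
field tested against `χ` tends in probability to `∫ χ (|u|²/2 + 3θ/2) ρ₀` (kinetic-energy
fluctuation + density field with the continuous weight `χ(|u|²/2 + 3θ/2)`,
`empiricalEnergyField_sub`). [folklore] -/
theorem tendsto_energy (ha : Continuous a) (hθ : Continuous θ) (hu : Continuous u)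
    (ha0 : ∀ x, 0 ≤ a x) (hθ0 : ∀ x, 0 < θ x)
    (hP : ∀ N, IsProbabilityMeasure (localGibbsMeasure σ a u θ N)) {ρ₀ : T3 → ℝ}
    (hD : ∀ χ : T3 → ℝ, Continuous χ → ∀ δ : ℝ, 0 < δ →
      Tendsto (fun N => localGibbsMeasure σ a u θ N
        {w | δ < |empiricalDensityField w χ - ∫ y, χ y * ρ₀ y|}) atTop (𝓝 0))
    {χ : T3 → ℝ} (hχ : Continuous χ) {δ : ℝ} (hδ : 0 < δ) :
    Tendsto (fun N => localGibbsMeasure σ a u θ N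
      {w | δ < |empiricalEnergyField w χ -
        ∫ y, χ y * (‖u y‖ ^ 2 / 2 + Fintype.card (Fin 3) * θ y / 2) * ρ₀ y|}) atTop (𝓝 0) := by
  obtain ⟨Θ, hΘ0, hΘ⟩ := exists_forall_abs_le_of_continuous hθ
  obtain ⟨U, hU0, hU⟩ := exists_forall_abs_le_of_continuous (continuous_norm.comp hu)
  have hmem : ∀ x, MemLp (fun v : V3 => ‖v‖ ^ 2 / 2 - ‖u x‖ ^ 2 / 2 -
      Fintype.card (Fin 3) * θ x / 2) 2 (gaussMeasure (u x) (θ x)) := fun x => by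
    have : (fun v : V3 => ‖v‖ ^ 2 / 2 - ‖u x‖ ^ 2 / 2 - Fintype.card (Fin 3) * θ x / 2) =
        fun v => ‖v‖ ^ 2 / 2 - (‖u x‖ ^ 2 / 2 + Fintype.card (Fin 3) * θ x / 2) := by
      funext v
      ring
    rw [this]
    exact memLp_energy_gaussMeasure _ _ _
  have hA := tendsto_velFluct ha hθ hu ha0 hθ0 hP
    (Y := fun x v => ‖v‖ ^ 2 / 2 - ‖u x‖ ^ 2 / 2 - Fintype.card (Fin 3) * θ x / 2)
    (by fun_prop) hmem (fun x => integral_energy_gaussMeasure (u x) (hθ0 x))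
    (B := 2 * 3 * Θ * U ^ 2 + Θ ^ 2 / 2 * gaussFourthMomentConst (Fin 3)) (fun x => by
      rw [variance_eq_sub (hmem x), integral_energy_gaussMeasure (u x) (hθ0 x)]
      simp only [ne_eq, OfNat.ofNat_ne_zero, not_false_eq_true, zero_pow, sub_zero]
      have hθΘ : θ x ≤ Θ := (le_abs_self _).trans (hΘ x)
      have h1 : θ x * ‖u x‖ ^ 2 ≤ Θ * U ^ 2 :=
        mul_le_mul hθΘ (pow_le_pow_left₀ (norm_nonneg _) ((le_abs_self _).trans (hU x)) 2)
          (sq_nonneg _) hΘ0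
      have h2 : θ x ^ 2 * gaussFourthMomentConst (Fin 3) ≤
          Θ ^ 2 * gaussFourthMomentConst (Fin 3) :=
        mul_le_mul_of_nonneg_right (pow_le_pow_left₀ (hθ0 x).le hθΘ 2)
          gaussFourthMomentConst_nonneg
      calc ∫ v, ((fun v : V3 => ‖v‖ ^ 2 / 2 - ‖u x‖ ^ 2 / 2 -
            Fintype.card (Fin 3) * θ x / 2) ^ 2) v ∂gaussMeasure (u x) (θ x)
          = ∫ v, (‖v‖ ^ 2 / 2 - ‖u x‖ ^ 2 / 2 - Fintype.card (Fin 3) * θ x / 2) ^ 2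
              ∂gaussMeasure (u x) (θ x) := rfl
        _ ≤ 2 * Fintype.card (Fin 3) * θ x * ‖u x‖ ^ 2 +
              θ x ^ 2 / 2 * gaussFourthMomentConst (Fin 3) :=
            integral_energy_sq_gaussMeasure_le (u x) (hθ0 x)
        _ ≤ 2 * 3 * Θ * U ^ 2 + Θ ^ 2 / 2 * gaussFourthMomentConst (Fin 3) := by
            simp only [Fintype.card_fin, Nat.cast_ofNat]
            linarith)
    hχ (half_pos hδ)
  have hB := hD (fun y => χ y * (‖u y‖ ^ 2 / 2 + Fintype.card (Fin 3) * θ y / 2))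
    (by fun_prop) (δ / 2) (half_pos hδ)
  refine (tendsto_measure_lt_abs_add hA hB).congr fun N => ?_
  congr 1
  ext w
  simp only [Set.mem_setOf_eq]
  rw [empiricalEnergyField_sub w χ u θ, empiricalDensityField_eq_sum,
    show (2 : ℝ) * (δ / 2) = δ by ring]

/-! ### Identification of the profiles -/

/-- **The velocity profile is identified.** If under the `(N+1)`-sphere local Gibbs measures of
`(a, u, θ)` the empirical density fields tend to `ρ₀` and the empirical momentum fields to
`ρ₀ U₀` (continuous, `ρ₀ > 0`), then `U₀ = u`. [folklore] -/
theorem velocity_eq (ha : Continuous a) (hθ : Continuous θ) (hu : Continuous u)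
    (ha0 : ∀ x, 0 ≤ a x) (hθ0 : ∀ x, 0 < θ x)
    (hP : ∀ N, IsProbabilityMeasure (localGibbsMeasure σ a u θ N)) {ρ₀ : T3 → ℝ} {U₀ : T3 → V3}
    (hρc : Continuous ρ₀) (hUc : Continuous U₀) (hρ0 : ∀ x, 0 < ρ₀ x)
    (hD : ∀ χ : T3 → ℝ, Continuous χ → ∀ δ : ℝ, 0 < δ →
      Tendsto (fun N => localGibbsMeasure σ a u θ N
        {w | δ < |empiricalDensityField w χ - ∫ y, χ y * ρ₀ y|}) atTop (𝓝 0))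
    (hM : ∀ χ : T3 → ℝ, Continuous χ → ∀ δ : ℝ, 0 < δ →
      Tendsto (fun N => localGibbsMeasure σ a u θ N
        {w | δ < ‖empiricalMomentumField w χ - ∫ y, (χ y * ρ₀ y) • U₀ y‖}) atTop (𝓝 0)) :
    U₀ = u := by
  funext x
  ext l
  have key : (fun y => ρ₀ y * U₀ y l) = fun y => ρ₀ y * u y l := by
    refine DenseExcursionAtTimeZero.eq_of_forall_integral_mul_eq (hρc.mul (by fun_prop))
      (hρc.mul (by fun_prop)) fun χ hχ => ?_
    rw [← integral_smul_apply_eq hχ hρc hUc l,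
      show ∫ y, χ y * (ρ₀ y * u y l) = ∫ y, χ y * u y l * ρ₀ y from
        integral_congr_ae (Eventually.of_forall fun y => by simp only; ring)]
    refine DenseExcursionAtTimeZero.eq_of_tendsto_measure_lt_abs
      (P := fun N => localGibbsMeasure σ a u θ N) (F := fun N w => empiricalMomentumField w χ l)
      (Eventually.of_forall hP) (fun δ hδ => ?_) (fun δ hδ => ?_)
    · refine tendsto_of_tendsto_of_tendsto_of_le_of_le tendsto_const_nhds (hM χ hχ δ hδ)
        (fun _ => zero_le) (fun N => measure_mono fun w hw => ?_)
      simp only [Set.mem_setOf_eq] at hw ⊢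
      refine hw.trans_le ?_
      rw [← PiLp.sub_apply, ← Real.norm_eq_abs]
      exact PiLp.norm_apply_le _ l
    · exact tendsto_momentum_apply ha hθ hu ha0 hθ0 hP hD hχ l hδ
  exact mul_left_cancel₀ (hρ0 x).ne' (congrFun key x)

/-- **The temperature profile is identified.** If moreover the empirical energy fields tend to
`ρ₀(|u|²/2 + 3Θ₀/2)` (the velocity profile being already identified), then `Θ₀ = θ`. [folklore] -/
theorem temperature_eq (ha : Continuous a) (hθ : Continuous θ) (hu : Continuous u)
    (ha0 : ∀ x, 0 ≤ a x) (hθ0 : ∀ x, 0 < θ x)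
    (hP : ∀ N, IsProbabilityMeasure (localGibbsMeasure σ a u θ N)) {ρ₀ Θ₀ : T3 → ℝ}
    (hρc : Continuous ρ₀) (hΘc : Continuous Θ₀) (hρ0 : ∀ x, 0 < ρ₀ x)
    (hD : ∀ χ : T3 → ℝ, Continuous χ → ∀ δ : ℝ, 0 < δ →
      Tendsto (fun N => localGibbsMeasure σ a u θ N
        {w | δ < |empiricalDensityField w χ - ∫ y, χ y * ρ₀ y|}) atTop (𝓝 0))
    (hE : ∀ χ : T3 → ℝ, Continuous χ → ∀ δ : ℝ, 0 < δ →
      Tendsto (fun N => localGibbsMeasure σ a u θ N {w | δ < |empiricalEnergyField w χ -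
        ∫ y, χ y * totalEnergyDensity (ρ₀ y) (u y) (Θ₀ y)|}) atTop (𝓝 0)) :
    Θ₀ = θ := by
  funext x
  have key : (fun y => totalEnergyDensity (ρ₀ y) (u y) (Θ₀ y)) =
      fun y => totalEnergyDensity (ρ₀ y) (u y) (θ y) := by
    refine DenseExcursionAtTimeZero.eq_of_forall_integral_mul_eq
      (by unfold totalEnergyDensity; fun_prop) (by unfold totalEnergyDensity; fun_prop)
      fun χ hχ => ?_
    have hI : ∫ y, χ y * totalEnergyDensity (ρ₀ y) (u y) (θ y) =
        ∫ y, χ y * (‖u y‖ ^ 2 / 2 + Fintype.card (Fin 3) * θ y / 2) * ρ₀ y := by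
      refine integral_congr_ae (Eventually.of_forall fun y => ?_)
      simp only [totalEnergyDensity, Fintype.card_fin, Nat.cast_ofNat]
      ring
    rw [hI]
    exact DenseExcursionAtTimeZero.eq_of_tendsto_measure_lt_abs
      (P := fun N => localGibbsMeasure σ a u θ N) (F := fun N w => empiricalEnergyField w χ)
      (Eventually.of_forall hP) (hE χ hχ)
      (fun δ hδ => tendsto_energy ha hθ hu ha0 hθ0 hP hD hχ hδ)
  have hx := congrFun key x
  simp only [totalEnergyDensity] at hx
  have := mul_left_cancel₀ (hρ0 x).ne' hx
  linarith

/-! ### The registered stub -/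

/-- **STUB `stub_profileIdOne` (profile identification, `(N+1)`-sphere local Gibbs family).** Under
the local Gibbs laws `localGibbsLaw σ a u θ N (Φ N)` (probability measures) of continuous profiles
`a, θ > 0`, `u`, if the empirical fields at time `0` satisfy the law of large numbers
`TendstoHydroFieldsAt … (fun _ => ρ₀) (fun _ => U₀) (fun _ => Θ₀) 0` towards continuous
`ρ₀ > 0`, `U₀`, `Θ₀`, then `U₀ = u` and `Θ₀ = θ` pointwise. The flow at time `0` is dropped by
`localGibbsLaw_preimage_flow_zero`; then `velocity_eq` and `temperature_eq`. [folklore] -/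
theorem stub_profileIdOne :
    ∀ (a θ : T3 → ℝ) (u : T3 → V3), Continuous a → Continuous θ → Continuous u →
      (∀ x, 0 < a x) → (∀ x, 0 < θ x) →
    ∀ σ : ℝ, 0 < σ → ∀ Φ : (N : ℕ) → HardSphereFlow G3 (hsDiameter σ N) (N + 1),
      (∀ N, IsProbabilityMeasure (localGibbsLaw σ a u θ N (Φ N))) →
    ∀ (ρ₀ Θ₀ : T3 → ℝ) (U₀ : T3 → V3), Continuous ρ₀ → Continuous U₀ → Continuous Θ₀ →
      (∀ x, 0 < ρ₀ x) →
      TendstoHydroFieldsAt (fun N => localGibbsLaw σ a u θ N (Φ N)) Φ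
        (fun _ => ρ₀) (fun _ => U₀) (fun _ => Θ₀) 0 →
      ∀ x, U₀ x = u x ∧ Θ₀ x = θ x := by
  intro a θ u ha hθ hu ha0 hθ0 σ _hσ Φ hPΦ ρ₀ Θ₀ U₀ hρc hUc hΘc hρ0 hT x
  have hP : ∀ N, IsProbabilityMeasure (localGibbsMeasure σ a u θ N) := fun N => by
    rw [← localGibbsLaw_eq σ a u θ N (Φ N)]
    exact hPΦ N
  have ha0' : ∀ y, 0 ≤ a y := fun y => (ha0 y).le
  have hD : ∀ χ : T3 → ℝ, Continuous χ → ∀ δ : ℝ, 0 < δ →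
      Tendsto (fun N => localGibbsMeasure σ a u θ N
        {w | δ < |empiricalDensityField w χ - ∫ y, χ y * ρ₀ y|}) atTop (𝓝 0) :=
    fun χ hχ δ hδ => (hT χ hχ δ hδ).1.congr fun N => localGibbsLaw_preimage_flow_zero σ a u θ N
      (Φ N) {w | δ < |empiricalDensityField w χ - ∫ y, χ y * ρ₀ y|}
  have hM : ∀ χ : T3 → ℝ, Continuous χ → ∀ δ : ℝ, 0 < δ →
      Tendsto (fun N => localGibbsMeasure σ a u θ N
        {w | δ < ‖empiricalMomentumField w χ - ∫ y, (χ y * ρ₀ y) • U₀ y‖}) atTop (𝓝 0) :=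
    fun χ hχ δ hδ => (hT χ hχ δ hδ).2.1.congr fun N => localGibbsLaw_preimage_flow_zero σ a u θ N
      (Φ N) {w | δ < ‖empiricalMomentumField w χ - ∫ y, (χ y * ρ₀ y) • U₀ y‖}
  have hE : ∀ χ : T3 → ℝ, Continuous χ → ∀ δ : ℝ, 0 < δ →
      Tendsto (fun N => localGibbsMeasure σ a u θ N {w | δ < |empiricalEnergyField w χ -
        ∫ y, χ y * totalEnergyDensity (ρ₀ y) (U₀ y) (Θ₀ y)|}) atTop (𝓝 0) :=
    fun χ hχ δ hδ => (hT χ hχ δ hδ).2.2.congr fun N => localGibbsLaw_preimage_flow_zero σ a u θ N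
      (Φ N) {w | δ < |empiricalEnergyField w χ -
        ∫ y, χ y * totalEnergyDensity (ρ₀ y) (U₀ y) (Θ₀ y)|}
  have hU : U₀ = u := velocity_eq ha hθ hu ha0' hθ0 hP hρc hUc hρ0 hD hM
  subst hU
  exact ⟨rfl, congrFun (temperature_eq ha hθ hu ha0' hθ0 hP hρc hΘc hρ0 hD hE) x⟩

end

end Summit.AtomisticToContinuum.HydrodynamicLimit.Theorems.LightConeInLawSketch.ProfileIdOne
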